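import Literature.MathematicalPhysics.QuantumFieldTheory.Balaban1983to89.B8SockHFPTraceFree
import Literature.MathematicalPhysics.QuantumFieldTheory.Balaban1983to89.B8Thm2TorusLetters

/-!
# `Balaban1983to89.B8SockHFPTorusTraceFree` — [Balaban1985RegularSpaces] Proposition 5's ∃λ-body WITH `τ(λ) = 0` at the TORUS members for ONE
# periodic background, served from the [4] letters `LettersAt` + the J-SU add-on `LettersTau` (sub-row «G-B8-T2S», route P, layer L4 §2a)

statement-level skeleton of published theorems with citation tags; proofs where landed; nothing here is a claim about the
Yang–Mills mass gap

T. Bałaban, *Spaces of regular gauge field configurations …*, Commun. Math. Phys. **99** (1985) 75–102 `[Balaban1985RegularSpaces]` ("B8"): Prop. 5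
(1.106)–(1.109) p. 94, Thm 4 p. 88, (1.67)–(1.69) p. 88, p. 77 («Ω_j = T_η»), p. 76 (`G = SU(N)`); [4] `[Balaban1985BackgroundPropagators]` Thms 3.1–3.3.
STATUS: published, refereed.

CITATION HEADER (lean-in-tree rule).  Cell `lit-balaban`, seat `lit-balaban-t2s-1` (gen 0), sub-row «G-B8-T2S» (R3 `stmt-QuantumFields-19200`), route P
layer L4 §2a (`lit-balaban-t2s-1/J-SU-ROADMAP.md`).  WHAT IS REPRODUCED.  `B8SockHFPRD.sockHFP_of_sockLettersRD` VERBATIM in structure, at the torus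
member family (`Ω_j = T_η = univ`, `Λs n = torusLam n`, `Λb n = torusLamb n`), for ONE background pair `(U₀, U′)` and ONE `(α₀, α₁)`, over the
trace-free body `B8SockHFPTraceFree.sockHFP_body_of_join_RD_traceFree`, with the letters read from t2s-1's `B8Thm2TorusLetters.LettersAt` (fields
(E1)–(E16)) and their `τ`-laws from `LettersTau` (v2):
* ★ `sockHFPτ_family_of_lettersAt` — for every level `1 ≤ m < k` and every `G`-valued level-`m` datum `(u₁, U₁ = U′^{u₁⁻¹}, A)` of Theorem 4's
  induction on `T_η`, a Hermitian `τ`-FREE `λ` with (1.108), the multiplier form of the Landau equation at `m + 1` levels and (1.29) for `u₁e^{iλ}`.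
  The datum's exponent is `τ`-free on every bond because `e^{iηA} = U₁` is `G ≤ H`-valued within `⅛` of `1` ((H2) + `log ∘ exp = id`).
NOT CLAIMED: the base family (`u₁ = 1`; analogous, §2a′), the windows' threshold (`B8SockHFPRD.exists_threshold_sockHFP_pairRD` serves `hwin`), the
step to `SockP5Step` (`B8Thm2TorusServerP.sockP5Step_body_of_traceFree`, needs «exactly one»).

HONEST SCOPE.  Plumbing; no new analysis.  Count-neutral; N05 ∕ `stub_PV3A` NOT discharged; nothing continuum ∕ ℝ⁴ ∕ OS ∕ mass-gap ∕ Clay.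
No `sorry`, no `def`, no `… : Prop` fact, no `instance`, no `notation`.
-/

noncomputable section

open NormedSpace
open scoped BigOperators

namespace Literature.MathematicalPhysics.QuantumFieldTheory.Balaban1983to89.B8SockHFPTorusTraceFree

open Complex (I)
open MatrixLog (mlog)
open B7Prop1Explicit B7Prop2Explicit B7Prop1Local B7Eq92Concrete
open B7Prop2Explicit (C0 c2')
open B7Prop3Flat (c3)
open B7Prop10General (C6 C4G)
open B7Prop9Flat (C5')
open B7Eq78Linearization (conjR zdBlocking QprimeIter)
open B8Ineq132 (covDerivFwd covDeriv InAk)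
open B8Eq119TwistedAxial (Restr129 InAx bgT)
open B8Eq184Proof (gaugeExp cfgExp)
open B8Eq182Proof (gAd)
open B8Eq188Proof (frakF3)
open B8Lemma1NonAbelian (mulCfg)
open B8Eq140Level (SideTouches)
open B8Ineq130 (tlo thi)
open B8Thm2LogB (blockTop)
open B8Eq138LandauZd (IsLandau138W covDivB covLap QT)
open B8Ineq125Concrete (C2p)
open B8Eq1117Concrete (XSpace)
open B8LeafModelZd3 (SockB9P3)
open B8Prop5ContractionKLevel (Bd2 Mc Kc)
open B8LambdaSpaceKLevel (wt)
open B8Thm4TorusAt (torusLam mem_torusLam_iff)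
open B8Thm2TorusMember (torusLamb mem_torusLamb_iff)
open B8Thm2TorusLetters (LettersAt LettersTau torus_member_laws)
open B8SockHFPTraceFree (sockHFP_body_of_join_RD_traceFree sockHFP₀_body_of_join_RD_traceFree)

-- `Site` alone could resolve to the torus sites of `Setup.lean`; re-export the `ℤ^d` sites of `B7Prop1Explicit`.
export B7Prop1Explicit (Site)

variable {d : ℕ} {𝔸 : Type*} [CStarAlgebra 𝔸] [Nontrivial 𝔸]

omit [Nontrivial 𝔸] in
/-- `‖e^{i s} − 1‖ ≤ ⅛` for `‖s‖ ≤ 1/16` (`‖eᵃ − 1‖ ≤ e^{‖a‖} − 1 ≤ ‖a‖ + ‖a‖²` for `‖a‖ ≤ 1`). [cite: Balaban1985Averaging, (22)–(23) p.21] -/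
theorem norm_exp_I_smul_sub_one_le_eighth {s : 𝔸} (hs : ‖s‖ ≤ 1 / 16) : ‖exp (I • s) - 1‖ ≤ 1 / 8 := by
  have h1 := Literature.Analysis.Calculus.norm_exp_sub_one_le (I • s)
  have hn : ‖I • s‖ = ‖s‖ := by rw [norm_smul, Complex.norm_I, one_mul]
  rw [hn] at h1
  have hx0 : 0 ≤ ‖s‖ := norm_nonneg _
  have h2 : Real.exp ‖s‖ ≤ 1 + ‖s‖ + ‖s‖ ^ 2 := by
    have := (abs_le.mp (Real.abs_exp_sub_one_sub_id_le (x := ‖s‖) (abs_le.mpr ⟨by linarith, by linarith⟩))).2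
    linarith
  nlinarith

omit [Nontrivial 𝔸] in
/-- **The exponent of a `G`-valued small datum is `τ`-free**: if `e^{iηA(b)} ∈ G ≤ H` with `‖ηA(b)‖ ≤ 1/16` and (H2) holds for `H`, then `τ(A(b)) = 0`
(`log e^{iηA} = iηA` for `‖ηA‖ < ln 2`, `B7BlockAvgLog.mlog_exp`). [cite: Balaban1985RegularSpaces, p.76, (1.69) p.88; Balaban1985Averaging, p.20, (21)–(23) p.21] -/
theorem apply_eq_zero_of_cfgExp_mem (τ : 𝔸 →L[ℂ] ℂ) {G H : Subgroup 𝔸ˣ} (hGH : G ≤ H)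
    (hGrp2 : ∀ g ∈ H, ‖(g : 𝔸) - 1‖ ≤ 1 / 8 → τ (mlog (g : 𝔸)) = 0) {η : ℝ} (hη : 0 < η)
    {A : Site d → Fin d → 𝔸} {x : Site d} {κ : Fin d} (hmem : cfgExp η A x κ ∈ G) (hsmall : η * ‖A x κ‖ ≤ 1 / 16) : τ (A x κ) = 0 := by
  have hn : ‖η • A x κ‖ ≤ 1 / 16 := by rw [norm_smul, Real.norm_eq_abs, abs_of_pos hη]; exact hsmall
  have hval : ((cfgExp η A x κ : 𝔸ˣ) : 𝔸) = exp (I • (η • A x κ)) := rfl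
  have h8 : ‖((cfgExp η A x κ : 𝔸ˣ) : 𝔸) - 1‖ ≤ 1 / 8 := by rw [hval]; exact norm_exp_I_smul_sub_one_le_eighth hn
  have hlog := hGrp2 _ (hGH hmem) h8
  have hlt : ‖I • (η • A x κ)‖ < Real.log 2 := by
    rw [norm_smul, Complex.norm_I, one_mul]
    have := Real.log_two_gt_d9; linarith
  have hsm : I • (η • A x κ) = ((I * (η : ℂ)) : ℂ) • A x κ := by
    rw [RCLike.real_smul_eq_coe_smul (K := ℂ) η (A x κ), smul_smul]; rfl
  rw [hval, B7BlockAvgLog.mlog_exp hlt, hsm, map_smul, smul_eq_mul] at hlog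
  have hI : (I : ℂ) ≠ 0 := Complex.I_ne_zero
  have hη' : ((η : ℝ) : ℂ) ≠ 0 := by exact_mod_cast hη.ne'
  exact (mul_eq_zero.1 hlog).resolve_left (mul_ne_zero hI hη')

section Family

variable (τ : 𝔸 →L[ℂ] ℂ)

/-- ★ **THE `τ`-FREE ∃λ-BODY FAMILY OF `SockHFP` AT THE TORUS MEMBER OF TOP LEVEL `k`, FOR ONE BACKGROUND PAIR, FROM THE LETTERS** (route P, L4 §2a):
for `(α₀, α₁)` with the JOIN's windows (`hwin`, the conjunction of `B8SockHFPRD.sockHFP_of_sockLettersRD` at this pair; served by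
`exists_threshold_sockHFP_pairRD`), `G`-valued `U₀, U′` with (1.33)/(1.34)/`InAx`/(1.35)-(1.66) at all truncations on `T_η`, the letters `ℓ : LettersAt … k α₀ U₀`
with `τ`-laws `LettersTau τ ℓ`, the b9 socket at every level, and the group data `G ≤ H` ((H2), (H3), `G` averaging-closed unitary): for every `1 ≤ m < k`
and every `G`-valued level-`m` datum `(u₁, U₁, A)` (`U₁^{u₁} = U′`, (1.29) at `m` levels, Landau at `m` levels, `U₁ = e^{iηA}`, `A` Hermitian,
`|A| ≤ c⋆(Lʲη)⁻¹` on the bonds touching `T_η`), there is `λ` Hermitian, **`τ`-free**, with (1.108) at `8B₀′c⋆`, the multiplier form of the Landau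
equation at `m + 1` levels and (1.29) at `m + 1` levels for `u₁e^{iλ}` — `B8SockHFPTraceFree.sockHFP_body_of_join_RD_traceFree` with the letters
`ℓ.Gp (m+1), ℓ.lapU (m+1), ℓ.Qp (m+1), ℓ.QpT (m+1), ℓ.Aw (m+1), ℓ.Cinv (m+1), ℓ.Hp (m+1)` and their laws (E1)–(E16), `τ`-laws from `LettersTau`, the
datum's exponent `τ`-free by `apply_eq_zero_of_cfgExp_mem`.
[cite: Balaban1985RegularSpaces, Prop. 5 (1.106)–(1.109) p.94, Thm 4 p.88, (1.67)–(1.69) p.88, p.89, p.77, p.76; Balaban1985BackgroundPropagators, Thm 3.1 p.397, Thm 3.3 p.399] -/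
theorem sockHFPτ_family_of_lettersAt (hτ : ∀ x y : 𝔸, τ (x * y) = τ (y * x)) (hd2 : 2 ≤ d) {L : ℕ} (hL : 2 ≤ L) {η : ℝ} (hη : 0 < η) {k : ℕ}
    {G H : Subgroup 𝔸ˣ} (hGrp2 : ∀ g ∈ H, ‖(g : 𝔸) - 1‖ ≤ 1 / 8 → τ (mlog (g : 𝔸)) = 0) (hGrp3 : ∀ S : 𝔸, τ S = 0 → expUnit S ∈ H)
    (hGA : AvgClosed d L G) (hGH : G ≤ H) (hGu : G ≤ unitaryUnits 𝔸)
    {α₀ α₁ B₀ B₀' B₀'H B₂' BG BR B₀β cB9 cB β : ℝ} {len : Site d → ℝ} (hα₀ : 0 < α₀) (hα₁ : 0 < α₁)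
    (hB₀ : 0 < B₀) (hB₀' : 0 < B₀') (hB₀'H : 0 < B₀'H) (hB₂' : 0 ≤ B₂') (hBG : 0 ≤ BG) (hBR : 0 ≤ BR)
    {U₀ U' : Site d → Fin d → 𝔸ˣ} (hU₀G : ∀ x κ, U₀ x κ ∈ G) (hU'G : ∀ x κ, U' x κ ∈ G)
    (h33 : InAk L k η α₀ (fun _ => (Set.univ : Set (Site d))) U₀) (h34 : InAk L k η α₀ (fun _ => (Set.univ : Set (Site d))) (mulCfg U' U₀))
    (hAx : ∀ m', m' ≤ k → InAx L m' (torusLam (d := d) m') U₀ (mulCfg U' U₀))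
    (h135 : ∀ j, j ≤ k → ∀ (z : Site d) (μ : Fin d), (∀ x, InBox (loK L j z) (bondHiK L j z μ) x → x ∈ (fun _ => (Set.univ : Set (Site d))) j) →
      ‖(avgIter L (mulCfg U' U₀) j z μ : 𝔸) - (avgIter L U₀ j z μ : 𝔸)‖ ≤ α₁)
    (ℓ : LettersAt (𝔸 := 𝔸) L BG BR B₀'H B₂' B₀ B₀β cB β len η k α₀ U₀) (ℓτ : LettersTau (𝔸 := 𝔸) τ ℓ)
    (SB9all : ∀ m, m ≤ k → SockB9P3 (𝔸 := 𝔸) L B₀ B₀β cB9 β len η m (fun _ => (Set.univ : Set (Site d)))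
      (fun m => torusLam (d := d) m) (fun m => torusLamb (d := d) m))
    (hwin : ∀ cs α₄ cB cDA hE hE₂ lE lE₂ : ℝ, cs = 5 * (d : ℝ) * L * B₀ * (α₀ + α₁) → α₄ = 8 * B₀' * (5 * (d : ℝ) * L * B₀) * (α₀ + α₁) →
      cB = L * cs → cDA = 2 * (d : ℝ) * (L : ℝ) ^ 2 * cs →
      hE = B₀'H * (C2p d * (40 * d * cB + α₄) * α₄) → hE₂ = B₂' * (C2p d * (40 * d * cB + α₄) * α₄) →
      lE = B₀'H * (4 * C2p d * (40 * d * cB + 2 * α₄)) → lE₂ = B₂' * (4 * C2p d * (40 * d * cB + 2 * α₄)) →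
      36 * d * B₀ * cs ≤ 1 / 2 ∧
      8 * (131072 * ((d : ℝ) + 1) ^ 2) * Real.exp (4 * (800 * ((d : ℝ) + 1) ^ 2 * ((d : ℝ) + 4)) * α₀) ≤ 16 * (131072 * ((d : ℝ) + 1) ^ 2) ∧
      2 * cs ^ 2 + 20 * d * α₀ * cs + 2 * (16 * (131072 * ((d : ℝ) + 1) ^ 2)) * cs ^ 2 ≤ α₀ + α₁ ∧
      (d : ℝ) * L * α₁ ≤ 1 / 8 ∧
      α₀ ≤ cB9 ∧ cs ≤ cB9 ∧
      C0 d * α₀ ≤ 1 / 3 ∧ 4 * α₀ ≤ c2' d L ∧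
      Real.exp (4 * (800 * ((d : ℝ) + 1) ^ 2 * ((d : ℝ) + 4)) * α₀) * (1 + 8 * (131072 * ((d : ℝ) + 1) ^ 2) * cB) ≤ 2 ∧
      2 * cB ≤ c3 d L ∧ 2048 * (d : ℝ) * cB ≤ 1 ∧ 40 * d * cB ≤ 1 / 200 ∧
      200 * C6 d * (2 * α₄) ≤ 1 ∧ 12000 * ((d : ℝ) + 1) * L * (2 * α₄) ≤ 1 ∧
      C4G d L * (α₀ + 40 * d * cB + 4 * (2 * α₄)) ≤ 1 ∧
      1024 * ((d : ℝ) + 1) * ((d : ℝ) + 4) * L ^ 2 * α₀ ≤ 1 ∧ 32 * ((d : ℝ) + 1) ^ 2 * C6 d * L ^ 2 * α₀ ≤ 1 ∧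
      16 * d * C5' d * C6 d * (L : ℝ) ^ 2 * α₀ ≤ 1 ∧ 8 * d * C6 d * L * α₀ ≤ 1 ∧
      40 * d * cB + α₄ ≤ 1 / (4 * B₀'H * (2 * C2p d)) ∧ 2 * C6 d * (40 * d * cB + 4 * α₄) ≤ 1 / 8 ∧
      cB ≤ 1 / 13 ∧ α₄ / 4 + hE ≤ 1 / 24 ∧ α₄ / 4 + hE ≤ 1 / 140 ∧ 10 * (α₄ / 4 + hE) * BR ≤ 1 / 2 ∧
      BG * Mc d BR (α₄ / 4 + hE) cB hE₂ cDA ≤ α₄ / 4 ∧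
      BG * Kc d BR (α₄ / 4 + hE) cB hE₂ cDA lE₂ (1 + lE) (1 + lE) ≤ 1 / 2) :
    ∀ m, 1 ≤ m → m < k → ∀ (u₁ : Site d → 𝔸ˣ) (U₁ : Site d → Fin d → 𝔸ˣ) (A : Site d → Fin d → 𝔸),
      (∀ x, u₁ x ∈ G) → mgauge U₀ u₁ U₁ = U' → Restr129 L m (torusLam (d := d) m) U₀ u₁ →
      IsLandau138W L m η (Set.univ : Set (Site d)) (torusLam (d := d) m) U₀ U₁ →
      (∀ j, j ≤ m → ∀ b ∈ {b : Site d × Fin d | SideTouches ((fun _ => (Set.univ : Set (Site d))) j) b.1 b.2},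
        U₁ b.1 b.2 = cfgExp η A b.1 b.2 ∧ IsSelfAdjoint (A b.1 b.2) ∧ ‖A b.1 b.2‖ ≤ (5 * (d : ℝ) * L * B₀ * (α₀ + α₁)) * ((L : ℝ) ^ j * η)⁻¹) →
      ∃ lam : Site d → 𝔸, (∀ x, IsSelfAdjoint (lam x)) ∧ (∀ x, x ∉ (fun _ => (Set.univ : Set (Site d))) 0 → lam x = 0) ∧ (∀ x, τ (lam x) = 0) ∧
        (∀ j, j ≤ m + 1 → ∀ b ∈ {b : Site d × Fin d | SideTouches ((fun _ => (Set.univ : Set (Site d))) j) b.1 b.2},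
          ‖lam b.1‖ ≤ 8 * B₀' * (5 * (d : ℝ) * L * B₀) * (α₀ + α₁) ∧
            ((L : ℝ) ^ j * η) * ‖covDerivFwd η U₀ b.2 lam b.1‖ ≤ 8 * B₀' * (5 * (d : ℝ) * L * B₀) * (α₀ + α₁)) ∧
        (∃ μ : ℕ → Site d → 𝔸, ∀ x ∈ (fun _ => (Set.univ : Set (Site d))) 0,
          covLap η U₀ (((fun _ => (Set.univ : Set (Site d))) 0).indicator fun y => covDivB η U₀ A y + covLap η U₀ lam y +
            ((conjR (gaugeExp lam y)⁻¹ (covDivB η U₀ A y) - covDivB η U₀ A y) +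
              (gAd (covLap η U₀ lam y) (lam y) - covLap η U₀ lam y) + ∑ μ, frakF3 η U₀ lam A y μ)) x =
            QT L (m + 1) ((fun m => torusLam (d := d) m) (m + 1)) U₀ μ x) ∧
        Restr129 L (m + 1) ((fun m => torusLam (d := d) m) (m + 1)) U₀ (u₁ * gaugeExp lam) := by
  intro m hm1 hmk u₁ U₁ A hu₁G hW h129 hLan hdat
  have hL1 : 1 ≤ L := le_trans (by norm_num) hL
  have hLr : (1 : ℝ) ≤ L := by exact_mod_cast hL1
  obtain ⟨hΩ, -, htw, h8lt, h8top⟩ := torus_member_laws (d := d) hL k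
  -- the windows at this (α₀, α₁)
  obtain ⟨hside, hC₂, h61, hsmall₁, hα₀9, hcs9, hα3, hα4, hsmall, hc₃, hsc, hα₃', hs₁, hs₂, hs₃, hs₄, hs₅, hs₆, hs₇, hsm, hprod8, hcA', ha₁',
    hb₁', hθ, h103, h106⟩ := hwin _ _ _ _ _ _ _ _ rfl rfl rfl rfl rfl rfl rfl rfl
  have hmK : m + 1 ≤ k := hmk
  have hcs0 : 0 ≤ 5 * (d : ℝ) * L * B₀ * (α₀ + α₁) := by
    have : 0 ≤ α₀ + α₁ := by linarith
    positivity
  have hcDAlo : (d : ℝ) * (L : ℝ) ^ 2 * (5 * (d : ℝ) * L * B₀ * (α₀ + α₁)) ≤ 2 * (d : ℝ) * (L : ℝ) ^ 2 * (5 * (d : ℝ) * L * B₀ * (α₀ + α₁)) := by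
    have h := mul_nonneg (by positivity : (0 : ℝ) ≤ (d : ℝ) * (L : ℝ) ^ 2) hcs0
    linarith only [h]
  -- unitary/`H`-valued data from `G`-valuedness
  have hU' : ∀ x κ, U' x κ ∈ unitaryUnits 𝔸 := fun x κ => hGu (hU'G x κ)
  have hu₁ : ∀ x, u₁ x ∈ unitaryUnits 𝔸 := fun x => hGu (hu₁G x)
  have hu₁H : ∀ x, u₁ x ∈ H := fun x => hGH (hu₁G x)
  -- member geometry at the torus: every constraint bond is interior, `Ω_j = T_η`
  have hbox : ∀ m, m ≤ k → ∀ j, j ≤ m → ∀ c ∈ (fun m => torusLamb (d := d) m) m j, ∀ x : Site d,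
      InBox (loK L j c.1) (bondHiK L j c.1 c.2) x → x ∈ (fun _ => (Set.univ : Set (Site d))) j := fun _ _ _ _ _ _ _ _ => Set.mem_univ _
  have hclass : ∀ m, m ≤ k → ∀ j, j ≤ m → ∀ c ∈ (fun m => torusLamb (d := d) m) m j,
      (c.1 ∈ (fun m => torusLam (d := d) m) m j ∧ c.1 + e c.2 ∈ (fun m => torusLam (d := d) m) m j) ∨
      (∃ j', j = j' + 1 ∧ (∀ x, (L : ℤ) • c.1 ≤ x → x ≤ (L : ℤ) • c.1 + blockTop L → x ∈ (fun m => torusLam (d := d) m) m j') ∧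
        c.1 + e c.2 ∈ (fun m => torusLam (d := d) m) m j) ∨
      (∃ j', j = j' + 1 ∧ c.1 ∈ (fun m => torusLam (d := d) m) m j ∧
        (∀ x, (L : ℤ) • (c.1 + e c.2) ≤ x → x ≤ (L : ℤ) • (c.1 + e c.2) + blockTop L → x ∈ (fun m => torusLam (d := d) m) m j')) := by
    intro m _ j _ c hc
    have hj : j = m := (mem_torusLamb_iff m j c).1 hc
    exact Or.inl ⟨(mem_torusLam_iff m j c.1).2 hj, (mem_torusLam_iff m j _).2 hj⟩
  -- the datum's exponent is `τ`-free on every bond: `e^{iηA} = U₁ = u₁⁻¹U′u₁(·+e)` is `G`-valued within `⅛` of `1`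
  have hU₁G : ∀ x κ, U₁ x κ ∈ G := by
    intro x κ
    have h := congrFun (congrFun hW x) κ
    rw [mgauge_apply] at h
    have hU₁ : U₁ x κ = (u₁ x)⁻¹ * U' x κ * Rc (U₀ x κ) (u₁ (x + e κ)) := by
      rw [← h]; group
    rw [hU₁, Rc_apply]
    exact G.mul_mem (G.mul_mem (G.inv_mem (hu₁G x)) (hU'G x κ))
      (G.mul_mem (G.mul_mem (hU₀G x κ) (hu₁G _)) (G.inv_mem (hU₀G x κ)))
  have h16 : 16 * (5 * (d : ℝ) * L * B₀ * (α₀ + α₁)) ≤ 1 := by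
    have hd0 : (1 : ℝ) ≤ d := by exact_mod_cast (show 1 ≤ d by omega)
    have hcsB : 5 * (d : ℝ) * L * B₀ * (α₀ + α₁) ≤ L * (5 * (d : ℝ) * L * B₀ * (α₀ + α₁)) := le_mul_of_one_le_left hcs0 hLr
    have hcBsmall : (d : ℝ) * (L * (5 * (d : ℝ) * L * B₀ * (α₀ + α₁))) ≤ 1 / 8000 := by linarith only [hα₃']
    have h1 : 5 * (d : ℝ) * L * B₀ * (α₀ + α₁) ≤ 1 / 8000 :=
      ((le_mul_of_one_le_left hcs0 hd0).trans (mul_le_mul_of_nonneg_left hcsB (by positivity))).trans hcBsmall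
    linarith only [h1]
  have hAτ : ∀ j, j ≤ m → ∀ b ∈ {b : Site d × Fin d | SideTouches ((fun _ => (Set.univ : Set (Site d))) j) b.1 b.2}, τ (A b.1 b.2) = 0 := by
    intro j hj b hb
    obtain ⟨hexp, -, hbd⟩ := hdat j hj b hb
    have hmem : cfgExp η A b.1 b.2 ∈ G := by rw [← hexp]; exact hU₁G b.1 b.2
    refine apply_eq_zero_of_cfgExp_mem τ hGH hGrp2 hη hmem ?_
    have hLj : (1 : ℝ) ≤ (L : ℝ) ^ j := one_le_pow₀ hLr
    calc η * ‖A b.1 b.2‖ ≤ η * ((5 * (d : ℝ) * L * B₀ * (α₀ + α₁)) * ((L : ℝ) ^ j * η)⁻¹) := mul_le_mul_of_nonneg_left hbd hη.le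
      _ = (5 * (d : ℝ) * L * B₀ * (α₀ + α₁)) * ((L : ℝ) ^ j)⁻¹ := by
          field_simp
      _ ≤ (5 * (d : ℝ) * L * B₀ * (α₀ + α₁)) * 1 := mul_le_mul_of_nonneg_left (inv_le_one_of_one_le₀ hLj) hcs0
      _ ≤ 1 / 16 := by linarith only [h16]
  -- the letters at the truncation `m + 1` and their `τ`-laws
  have hn1 : 1 ≤ m + 1 := by omega
  exact sockHFP_body_of_join_RD_traceFree τ hτ hd2 hL hη hGrp2 hGrp3 hGA hGH hGu hΩ hbox hclass hm1 hmk (htw (m + 1) hmK) (h8lt m hmk) (h8top m hmk)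
    hα₀ hα₁ hB₀ hB₀' rfl rfl hU₀G hU' h33 h34 hAx h135 hu₁ hu₁H hW h129 hLan hdat hAτ (SB9all m hmk.le) hα₀9 hcs9 hside hC₂ h61 hsmall₁
    (ℓ.Gp (m + 1)) (ℓ.lapU (m + 1)) (ℓ.Qp (m + 1)) (ℓ.QpT (m + 1)) (ℓ.Aw (m + 1)) (ℓ.Cinv (m + 1))
    (ℓ.gp_right (m + 1) hn1 hmK) (ℓ.cinv_range (m + 1) hn1 hmK) (ℓ.lapU_reads (m + 1) hn1 hmK) (ℓ.qpT_reads (m + 1) hn1 hmK)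
    (ℓ.qp_reads (m + 1) hn1 hmK) (ℓ.Hp (m + 1)) hB₀'H hB₂' hBG hBR (ℓ.hp_sup (m + 1) hn1 hmK) (ℓ.hp_grad (m + 1) hn1 hmK)
    (ℓ.hp_lap (m + 1) hn1 hmK) (ℓ.hp_dirichlet (m + 1) hn1 hmK) (ℓ.hp_real (m + 1) hn1 hmK) (ℓ.qp_hp (m + 1) hn1 hmK)
    (ℓ.gp_sup_grad (m + 1) hn1 hmK) (ℓ.gp_dirichlet (m + 1) hn1 hmK) (ℓ.gp_real (m + 1) hn1 hmK) (ℓ.r_bound (m + 1) hn1 hmK)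
    (ℓ.r_real (m + 1) hn1 hmK) (ℓτ.hp_tau (m + 1) hn1 hmK) (ℓτ.gp_tau (m + 1) hn1 hmK) (ℓτ.r_tau (m + 1) hn1 hmK)
    le_rfl le_rfl hcDAlo hα3 hα4 hsmall hc₃ hsc hα₃' hs₁ hs₂ hs₃ hs₄ hs₅ hs₆ hs₇ hsm hprod8 rfl rfl rfl rfl hcA' ha₁' hb₁' hθ h103 h106


/-- ★ **THE SAME FOR THE BASE DATUM `u₁ = 1`, `U₁ = U′`** (p. 89): the `τ`-free ∃λ-body of `SockHFP₀` at the torus member, for one `G`-valued background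
pair and one `(α₀, α₁)`, from the letters at truncation `1` (`B8SockHFPTraceFree.sockHFP₀_body_of_join_RD_traceFree`; no b9 socket, no (1.35) read).
[cite: Balaban1985RegularSpaces, Prop. 5 (1.106)–(1.109) p.94, p.89 (the start of the induction), p.77, p.76] -/
theorem sockHFP₀τ_family_of_lettersAt (hτ : ∀ x y : 𝔸, τ (x * y) = τ (y * x)) (hd2 : 2 ≤ d) {L : ℕ} (hL : 2 ≤ L) {η : ℝ} (hη : 0 < η) {k : ℕ}
    (hk : 1 ≤ k)
    {G H : Subgroup 𝔸ˣ} (hGrp2 : ∀ g ∈ H, ‖(g : 𝔸) - 1‖ ≤ 1 / 8 → τ (mlog (g : 𝔸)) = 0) (hGrp3 : ∀ S : 𝔸, τ S = 0 → expUnit S ∈ H)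
    (hGA : AvgClosed d L G) (hGH : G ≤ H) (hGu : G ≤ unitaryUnits 𝔸)
    {α₀ α₁ B₀ B₀' B₀'H B₂' BG BR B₀β cB9 cB β : ℝ} {len : Site d → ℝ} (hα₀ : 0 < α₀) (hα₁ : 0 < α₁)
    (hB₀ : 0 < B₀) (hB₀' : 0 < B₀') (hB₀'H : 0 < B₀'H) (hB₂' : 0 ≤ B₂') (hBG : 0 ≤ BG) (hBR : 0 ≤ BR)
    {U₀ U' : Site d → Fin d → 𝔸ˣ} (hU₀G : ∀ x κ, U₀ x κ ∈ G) (hU'G : ∀ x κ, U' x κ ∈ G)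
    (h33 : InAk L k η α₀ (fun _ => (Set.univ : Set (Site d))) U₀) (h34 : InAk L k η α₀ (fun _ => (Set.univ : Set (Site d))) (mulCfg U' U₀))
    (hAx : ∀ m', m' ≤ k → InAx L m' (torusLam (d := d) m') U₀ (mulCfg U' U₀))
    (ℓ : LettersAt (𝔸 := 𝔸) L BG BR B₀'H B₂' B₀ B₀β cB β len η k α₀ U₀) (ℓτ : LettersTau (𝔸 := 𝔸) τ ℓ)
    (hwin : ∀ cs α₄ cB cDA hE hE₂ lE lE₂ : ℝ, cs = 5 * (d : ℝ) * L * B₀ * (α₀ + α₁) → α₄ = 8 * B₀' * (5 * (d : ℝ) * L * B₀) * (α₀ + α₁) →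
      cB = L * cs → cDA = 2 * (d : ℝ) * (L : ℝ) ^ 2 * cs →
      hE = B₀'H * (C2p d * (40 * d * cB + α₄) * α₄) → hE₂ = B₂' * (C2p d * (40 * d * cB + α₄) * α₄) →
      lE = B₀'H * (4 * C2p d * (40 * d * cB + 2 * α₄)) → lE₂ = B₂' * (4 * C2p d * (40 * d * cB + 2 * α₄)) →
      36 * d * B₀ * cs ≤ 1 / 2 ∧
      8 * (131072 * ((d : ℝ) + 1) ^ 2) * Real.exp (4 * (800 * ((d : ℝ) + 1) ^ 2 * ((d : ℝ) + 4)) * α₀) ≤ 16 * (131072 * ((d : ℝ) + 1) ^ 2) ∧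
      2 * cs ^ 2 + 20 * d * α₀ * cs + 2 * (16 * (131072 * ((d : ℝ) + 1) ^ 2)) * cs ^ 2 ≤ α₀ + α₁ ∧
      (d : ℝ) * L * α₁ ≤ 1 / 8 ∧
      α₀ ≤ cB9 ∧ cs ≤ cB9 ∧
      C0 d * α₀ ≤ 1 / 3 ∧ 4 * α₀ ≤ c2' d L ∧
      Real.exp (4 * (800 * ((d : ℝ) + 1) ^ 2 * ((d : ℝ) + 4)) * α₀) * (1 + 8 * (131072 * ((d : ℝ) + 1) ^ 2) * cB) ≤ 2 ∧
      2 * cB ≤ c3 d L ∧ 2048 * (d : ℝ) * cB ≤ 1 ∧ 40 * d * cB ≤ 1 / 200 ∧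
      200 * C6 d * (2 * α₄) ≤ 1 ∧ 12000 * ((d : ℝ) + 1) * L * (2 * α₄) ≤ 1 ∧
      C4G d L * (α₀ + 40 * d * cB + 4 * (2 * α₄)) ≤ 1 ∧
      1024 * ((d : ℝ) + 1) * ((d : ℝ) + 4) * L ^ 2 * α₀ ≤ 1 ∧ 32 * ((d : ℝ) + 1) ^ 2 * C6 d * L ^ 2 * α₀ ≤ 1 ∧
      16 * d * C5' d * C6 d * (L : ℝ) ^ 2 * α₀ ≤ 1 ∧ 8 * d * C6 d * L * α₀ ≤ 1 ∧
      40 * d * cB + α₄ ≤ 1 / (4 * B₀'H * (2 * C2p d)) ∧ 2 * C6 d * (40 * d * cB + 4 * α₄) ≤ 1 / 8 ∧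
      cB ≤ 1 / 13 ∧ α₄ / 4 + hE ≤ 1 / 24 ∧ α₄ / 4 + hE ≤ 1 / 140 ∧ 10 * (α₄ / 4 + hE) * BR ≤ 1 / 2 ∧
      BG * Mc d BR (α₄ / 4 + hE) cB hE₂ cDA ≤ α₄ / 4 ∧
      BG * Kc d BR (α₄ / 4 + hE) cB hE₂ cDA lE₂ (1 + lE) (1 + lE) ≤ 1 / 2) :
    ∀ (A : Site d → Fin d → 𝔸),
      (∀ j, j ≤ 0 → ∀ b ∈ {b : Site d × Fin d | SideTouches ((fun _ => (Set.univ : Set (Site d))) j) b.1 b.2},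
        U' b.1 b.2 = cfgExp η A b.1 b.2 ∧ IsSelfAdjoint (A b.1 b.2) ∧ ‖A b.1 b.2‖ ≤ (5 * (d : ℝ) * L * B₀ * (α₀ + α₁)) * ((L : ℝ) ^ j * η)⁻¹) →
      ∃ lam : Site d → 𝔸, (∀ x, IsSelfAdjoint (lam x)) ∧ (∀ x, x ∉ (fun _ => (Set.univ : Set (Site d))) 0 → lam x = 0) ∧ (∀ x, τ (lam x) = 0) ∧
        (∀ j, j ≤ 1 → ∀ b ∈ {b : Site d × Fin d | SideTouches ((fun _ => (Set.univ : Set (Site d))) j) b.1 b.2},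
          ‖lam b.1‖ ≤ 8 * B₀' * (5 * (d : ℝ) * L * B₀) * (α₀ + α₁) ∧
            ((L : ℝ) ^ j * η) * ‖covDerivFwd η U₀ b.2 lam b.1‖ ≤ 8 * B₀' * (5 * (d : ℝ) * L * B₀) * (α₀ + α₁)) ∧
        (∃ μ : ℕ → Site d → 𝔸, ∀ x ∈ (fun _ => (Set.univ : Set (Site d))) 0,
          covLap η U₀ (((fun _ => (Set.univ : Set (Site d))) 0).indicator fun y => covDivB η U₀ A y + covLap η U₀ lam y +
            ((conjR (gaugeExp lam y)⁻¹ (covDivB η U₀ A y) - covDivB η U₀ A y) +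
              (gAd (covLap η U₀ lam y) (lam y) - covLap η U₀ lam y) + ∑ μ, frakF3 η U₀ lam A y μ)) x =
            QT L 1 ((fun m => torusLam (d := d) m) 1) U₀ μ x) ∧
        Restr129 L 1 ((fun m => torusLam (d := d) m) 1) U₀ ((1 : Site d → 𝔸ˣ) * gaugeExp lam) := by
  intro A hdat
  have hL1 : 1 ≤ L := le_trans (by norm_num) hL
  have hLr : (1 : ℝ) ≤ L := by exact_mod_cast hL1
  obtain ⟨hΩ, -, htw, -, -⟩ := torus_member_laws (d := d) hL k
  -- the windows at this (α₀, α₁)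
  obtain ⟨hside, hC₂, h61, hsmall₁, hα₀9, hcs9, hα3, hα4, hsmall, hc₃, hsc, hα₃', hs₁, hs₂, hs₃, hs₄, hs₅, hs₆, hs₇, hsm, hprod8, hcA', ha₁',
    hb₁', hθ, h103, h106⟩ := hwin _ _ _ _ _ _ _ _ rfl rfl rfl rfl rfl rfl rfl rfl
  have hcs0 : 0 ≤ 5 * (d : ℝ) * L * B₀ * (α₀ + α₁) := by
    have : 0 ≤ α₀ + α₁ := by linarith
    positivity
  -- the datum's exponent is `τ`-free on every bond: `e^{iηA} = U′` is `G`-valued within `⅛` of `1`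
  have h16 : 16 * (5 * (d : ℝ) * L * B₀ * (α₀ + α₁)) ≤ 1 := by
    have hd0 : (1 : ℝ) ≤ d := by exact_mod_cast (show 1 ≤ d by omega)
    have hcsB : 5 * (d : ℝ) * L * B₀ * (α₀ + α₁) ≤ L * (5 * (d : ℝ) * L * B₀ * (α₀ + α₁)) := le_mul_of_one_le_left hcs0 hLr
    have hcBsmall : (d : ℝ) * (L * (5 * (d : ℝ) * L * B₀ * (α₀ + α₁))) ≤ 1 / 8000 := by linarith only [hα₃']
    have h1 : 5 * (d : ℝ) * L * B₀ * (α₀ + α₁) ≤ 1 / 8000 :=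
      ((le_mul_of_one_le_left hcs0 hd0).trans (mul_le_mul_of_nonneg_left hcsB (by positivity))).trans hcBsmall
    linarith only [h1]
  have hAτ : ∀ j, j ≤ 0 → ∀ b ∈ {b : Site d × Fin d | SideTouches ((fun _ => (Set.univ : Set (Site d))) j) b.1 b.2}, τ (A b.1 b.2) = 0 := by
    intro j hj b hb
    obtain ⟨hexp, -, hbd⟩ := hdat j hj b hb
    have hmem : cfgExp η A b.1 b.2 ∈ G := by rw [← hexp]; exact hU'G b.1 b.2
    refine apply_eq_zero_of_cfgExp_mem τ hGH hGrp2 hη hmem ?_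
    have hLj : (1 : ℝ) ≤ (L : ℝ) ^ j := one_le_pow₀ hLr
    calc η * ‖A b.1 b.2‖ ≤ η * ((5 * (d : ℝ) * L * B₀ * (α₀ + α₁)) * ((L : ℝ) ^ j * η)⁻¹) := mul_le_mul_of_nonneg_left hbd hη.le
      _ = (5 * (d : ℝ) * L * B₀ * (α₀ + α₁)) * ((L : ℝ) ^ j)⁻¹ := by
          field_simp
      _ ≤ (5 * (d : ℝ) * L * B₀ * (α₀ + α₁)) * 1 := mul_le_mul_of_nonneg_left (inv_le_one_of_one_le₀ hLj) hcs0
      _ ≤ 1 / 16 := by linarith only [h16]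
  have hk1 : 1 ≤ k := hk
  exact sockHFP₀_body_of_join_RD_traceFree τ hτ hd2 hL hη hk hGrp2 hGrp3 hGA hGH hGu hΩ (htw 1 hk1) hα₀ hα₁ hB₀ hB₀' rfl rfl hU₀G h33 h34 hAx
    hdat hAτ (ℓ.Gp 1) (ℓ.lapU 1) (ℓ.Qp 1) (ℓ.QpT 1) (ℓ.Aw 1) (ℓ.Cinv 1)
    (ℓ.gp_right 1 le_rfl hk1) (ℓ.cinv_range 1 le_rfl hk1) (ℓ.lapU_reads 1 le_rfl hk1) (ℓ.qpT_reads 1 le_rfl hk1)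
    (ℓ.qp_reads 1 le_rfl hk1) (ℓ.Hp 1) hB₀'H hB₂' hBG hBR (ℓ.hp_sup 1 le_rfl hk1) (ℓ.hp_grad 1 le_rfl hk1)
    (ℓ.hp_lap 1 le_rfl hk1) (ℓ.hp_dirichlet 1 le_rfl hk1) (ℓ.hp_real 1 le_rfl hk1) (ℓ.qp_hp 1 le_rfl hk1)
    (ℓ.gp_sup_grad 1 le_rfl hk1) (ℓ.gp_dirichlet 1 le_rfl hk1) (ℓ.gp_real 1 le_rfl hk1) (ℓ.r_bound 1 le_rfl hk1)
    (ℓ.r_real 1 le_rfl hk1) (ℓτ.hp_tau 1 le_rfl hk1) (ℓτ.gp_tau 1 le_rfl hk1) (ℓτ.r_tau 1 le_rfl hk1)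
    le_rfl le_rfl le_rfl hα3 hα4 hsmall hc₃ hsc hα₃' hs₁ hs₂ hs₃ hs₄ hs₅ hs₆ hs₇ hsm hprod8 rfl rfl rfl rfl hcA' ha₁' hb₁' hθ h103 h106

end Family

#print axioms sockHFPτ_family_of_lettersAt
#print axioms sockHFP₀τ_family_of_lettersAt

end Literature.MathematicalPhysics.QuantumFieldTheory.Balaban1983to89.B8SockHFPTorusTraceFree

end
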